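import Mathlib.Analysis.Calculus.FDeriv.Analytic
import Mathlib.Analysis.Calculus.FDeriv.Mul
import Mathlib.Analysis.Calculus.IteratedDeriv.Lemmas
import Mathlib.Analysis.Analytic.Constructions
import Mathlib.Analysis.Analytic.Uniqueness
import Mathlib.Analysis.SpecialFunctions.Exponential
import Mathlib.Algebra.MvPolynomial.PDeriv
import Literature.RepresentationTheory.CompactGroups.CompactMatrixGroupAlgebraic
import HarnessLib

/-!
# The Lie algebra of a compact matrix group is its real Zariski tangent space

Topic `RepresentationTheory/CompactGroups`. Companion to `CompactMatrixGroupAlgebraic.lean`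
(Chevalley: a compact `K ≤ U(n)` is cut out inside `U(n)` by the polynomials vanishing on it).
Here we prove the REAL and INFINITESIMAL forms of the statement "compact linear groups are
algebraic" (C. Chevalley, *Theory of Lie Groups I* (1946), Ch. VI §§VIII–IX and Prop. 2 of §IX;
A. L. Onishchik, E. B. Vinberg, *Lie Groups and Algebraic Groups* (1990), Ch. 5 §2, Thm. 5 with
Ch. 3 §3.3–3.4: the tangent algebra of a real algebraic linear group is the Zariski tangent space
of its ideal at `1`): for a closed subgroup `K ≤ U(n)`, viewed inside the real vector space
`M_n(ℂ) ≅ ℝ^{2n²}`,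

* `exists_aeval_gen_eq_zero_ne_zero` — every `x ∈ U(n) ∖ K` is separated from `K` by a REAL
  polynomial in `Re U_{ij}, Im U_{ij}` vanishing on `K` (the real polynomial produced inside the
  proof of `mem_of_mem_zariskiClosure_of_mem_unitaryGroup`, exposed);
* `fderiv_eq_zero_iff_forall_exp_mem` — **a matrix `A` is annihilated by the differentials at
  `1` of all real polynomial functions vanishing on `K` if and only if `exp(tA) ∈ K` for all real
  `t`**, i.e. the real Zariski tangent space of `K` at `1` is the Lie algebra
  `𝔨 = {A | exp(ℝA) ⊆ K}` of the compact Lie group `K` (von Neumann–Cartan);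
* `exists_fin_polys_linearIndependent_tangent` — hence finitely many real polynomial functions
  `P₁, …, P_c` vanishing on `K`, with linearly independent differentials at `1`, whose joint
  kernel is exactly `𝔨` ("`K` is defined near `1` by equations of the right rank").

Polynomial functions on a real normed space `E` are written basis-free as
`MvPolynomial.aeval (fun ℓ : E →L[ℝ] ℝ => ⇑ℓ) P : E → ℝ` for `P` a polynomial in the continuous
linear functionals; §1 provides their calculus (`analyticAt_aeval_coeFn`,
`hasFDerivAt_aeval_coeFn`: `D P(x) = Σ_ℓ ∂_ℓP(x) · ℓ`, closure under precomposition with linear maps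
and under derivation along linear vector fields).

Proof of the tangent theorem (the standard argument that a real algebraic group is smooth with
Lie algebra its Zariski tangent space, run for the ideal `I(K)` of all real polynomial functions
vanishing on `K`, which is available without knowing `K` algebraic in advance): `I(K)` is stable
under right translations by `K` and therefore, for `A` in the Zariski tangent space `T`, under the
derivation `∂_A P (M) = DP(M)[AM]` along the right-invariant vector field of `A`
(`(∂_A P)(k) = D(P ∘ R_k)(1)[A] = 0`); hence all derivatives of the real-analytic function
`t ↦ P(exp tA)` vanish at `t = 0`, so `P(exp tA) = 0` for all `t` and all `P ∈ I(K)`; taking for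
`P` the unitarity relations shows `exp tA ∈ U(n)`, and the real separation theorem gives
`exp tA ∈ K`. Everything is proved; no definitions, no named facts.

## References

* C. Chevalley, *Theory of Lie Groups I*, Princeton (1946), Ch. VI §§VIII–IX. [Chevalley1946]
* A. L. Onishchik, E. B. Vinberg, *Lie Groups and Algebraic Groups*, Springer (1990), Ch. 3 §3,
  Ch. 5 §2 Thm. 5. [OnishchikVinberg1990]
* T. Bröcker, T. tom Dieck, *Representations of Compact Lie Groups* (1985), III §8.
  [BrockerTomDieck1985]
* B. C. Hall, *Lie Groups, Lie Algebras, and Representations*, 2nd ed. (2015), Thm. 3.42,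
  Cor. 3.45 (`𝔨 = {A | exp(ℝA) ⊆ K}` is the Lie algebra of the closed subgroup `K`). [Hall2015]
-/

noncomputable section

open Set Filter Topology MvPolynomial MeasureTheory

namespace Literature.RepresentationTheory.CompactGroups

open Literature.NumberTheory.Automorphic

/-! ### §1. Calculus of polynomial functions on a real normed space -/

section PolyCalculus

/-- Evaluating an `aeval` into the function algebra at a point is evaluating the polynomial at
the values of the generators. [folklore] -/
theorem aeval_pi_apply {E σ : Type*} (f : σ → E → ℝ) (Q : MvPolynomial σ ℝ) (x : E) :
    MvPolynomial.aeval (R := ℝ) f Q x = MvPolynomial.eval (fun s => f s x) Q := by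
  have h : MvPolynomial.aeval (R := ℝ) f Q x =
      ((Pi.evalAlgHom ℝ (fun _ : E => ℝ) x).comp (MvPolynomial.aeval (R := ℝ) f)) Q := rfl
  rw [h, MvPolynomial.comp_aeval, ← MvPolynomial.coe_aeval_eq_eval]
  rfl

variable {E : Type*} [NormedAddCommGroup E] [NormedSpace ℝ E]

/-- Evaluation of the polynomial function `aeval (fun ℓ => ⇑ℓ) P` at a point. [folklore] -/
theorem aeval_coeFn_apply (P : MvPolynomial (E →L[ℝ] ℝ) ℝ) (x : E) :
    MvPolynomial.aeval (R := ℝ) (fun ℓ : E →L[ℝ] ℝ => (ℓ : E → ℝ)) P x =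
      MvPolynomial.eval (fun ℓ : E →L[ℝ] ℝ => ℓ x) P :=
  aeval_pi_apply _ P x

/-- **Polynomial functions are real-analytic.** [folklore] -/
theorem analyticAt_aeval_coeFn (P : MvPolynomial (E →L[ℝ] ℝ) ℝ) (x : E) :
    AnalyticAt ℝ (MvPolynomial.aeval (R := ℝ) (fun ℓ : E →L[ℝ] ℝ => (ℓ : E → ℝ)) P) x := by
  induction P using MvPolynomial.induction_on with
  | C a =>
    rw [MvPolynomial.algHom_C]
    exact analyticAt_const
  | add p q hp hq =>
    rw [map_add]
    exact hp.add hq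
  | mul_X p ℓ hp =>
    rw [map_mul, MvPolynomial.aeval_X]
    exact hp.mul (ℓ.analyticAt x)

/-- **The differential of a polynomial function**: `D(P)(x) = Σ_{ℓ ∈ vars P} (∂_ℓ P)(x) · ℓ`.
[folklore] -/
theorem hasFDerivAt_aeval_coeFn [DecidableEq (E →L[ℝ] ℝ)] (P : MvPolynomial (E →L[ℝ] ℝ) ℝ)
    (x : E) :
    HasFDerivAt (MvPolynomial.aeval (R := ℝ) (fun ℓ : E →L[ℝ] ℝ => (ℓ : E → ℝ)) P)
      (∑ ℓ ∈ P.vars, (MvPolynomial.aeval (R := ℝ) (fun ℓ : E →L[ℝ] ℝ => (ℓ : E → ℝ))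
        (MvPolynomial.pderiv ℓ P) x) • (ℓ : E →L[ℝ] ℝ)) x := by
  -- the sum may be taken over any finite set of variables containing `vars P`
  have hsum : ∀ (Q : MvPolynomial (E →L[ℝ] ℝ) ℝ) (s : Finset (E →L[ℝ] ℝ)), Q.vars ⊆ s →
      ∑ ℓ ∈ s, (MvPolynomial.aeval (R := ℝ) (fun ℓ : E →L[ℝ] ℝ => (ℓ : E → ℝ))
        (MvPolynomial.pderiv ℓ Q) x) • (ℓ : E →L[ℝ] ℝ) =
      ∑ ℓ ∈ Q.vars, (MvPolynomial.aeval (R := ℝ) (fun ℓ : E →L[ℝ] ℝ => (ℓ : E → ℝ))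
        (MvPolynomial.pderiv ℓ Q) x) • (ℓ : E →L[ℝ] ℝ) := by
    intro Q s hs
    refine (Finset.sum_subset hs fun ℓ _ hℓ => ?_).symm
    rw [MvPolynomial.pderiv_eq_zero_of_notMem_vars hℓ, map_zero, Pi.zero_apply, zero_smul]
  induction P using MvPolynomial.induction_on with
  | C a =>
    rw [MvPolynomial.algHom_C, MvPolynomial.vars_C, Finset.sum_empty]
    exact hasFDerivAt_const _ _
  | add p q hp hq =>
    rw [map_add]
    refine (hp.add hq).congr_fderiv ?_
    set s := p.vars ∪ q.vars ∪ (p + q).vars with hs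
    rw [← hsum p s (Finset.subset_union_left.trans Finset.subset_union_left),
      ← hsum q s (Finset.subset_union_right.trans Finset.subset_union_left),
      ← hsum (p + q) s Finset.subset_union_right, ← Finset.sum_add_distrib]
    refine Finset.sum_congr rfl fun ℓ _ => ?_
    rw [map_add, map_add, Pi.add_apply, add_smul]
  | mul_X p ℓ₀ hp =>
    have hℓ₀ : HasFDerivAt (fun y : E => ℓ₀ y) ℓ₀ x := ℓ₀.hasFDerivAt
    rw [map_mul, MvPolynomial.aeval_X]
    refine (hp.mul hℓ₀).congr_fderiv ?_
    set s := p.vars ∪ {ℓ₀} ∪ (p * X ℓ₀).vars with hs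
    rw [← hsum (p * X ℓ₀) s Finset.subset_union_right,
      ← hsum p s (Finset.subset_union_left.trans Finset.subset_union_left)]
    have hℓ₀s : ℓ₀ ∈ s :=
      Finset.subset_union_left (Finset.mem_union_right _ (Finset.mem_singleton_self _))
    simp_rw [MvPolynomial.pderiv_mul, MvPolynomial.pderiv_X, map_add, map_mul,
      MvPolynomial.aeval_X, Pi.add_apply, Pi.mul_apply, add_smul, Finset.sum_add_distrib]
    rw [add_comm]
    congr 1
    · rw [Finset.smul_sum]
      refine Finset.sum_congr rfl fun ℓ _ => ?_
      rw [smul_smul, mul_comm]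
    · rw [Finset.sum_eq_single_of_mem ℓ₀ hℓ₀s]
      · simp
      · intro ℓ _ hne
        have : (Pi.single ℓ (1 : MvPolynomial (E →L[ℝ] ℝ) ℝ) : (E →L[ℝ] ℝ) → _) ℓ₀ = 0 :=
          Pi.single_eq_of_ne' hne _
        simp [this]

/-- The polynomial function is differentiable, with
`D(P)(x)(v) = Σ_{ℓ ∈ vars P} (∂_ℓ P)(x) · ℓ(v)`. [folklore] -/
theorem fderiv_aeval_coeFn_apply [DecidableEq (E →L[ℝ] ℝ)] (P : MvPolynomial (E →L[ℝ] ℝ) ℝ)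
    (x v : E) :
    fderiv ℝ (MvPolynomial.aeval (R := ℝ) (fun ℓ : E →L[ℝ] ℝ => (ℓ : E → ℝ)) P) x v =
      ∑ ℓ ∈ P.vars, MvPolynomial.aeval (R := ℝ) (fun ℓ : E →L[ℝ] ℝ => (ℓ : E → ℝ))
        (MvPolynomial.pderiv ℓ P) x * ℓ v := by
  rw [(hasFDerivAt_aeval_coeFn P x).fderiv, sum_apply]
  refine Finset.sum_congr rfl fun ℓ _ => ?_
  rw [smul_apply, smul_eq_mul]

/-- **Precomposition with a linear map preserves polynomial functions**: `P ∘ R = P'` with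
`P' = rename (· ∘ R) P`. [folklore] -/
theorem exists_aeval_coeFn_comp_clm (P : MvPolynomial (E →L[ℝ] ℝ) ℝ) (R : E →L[ℝ] E) :
    ∃ P' : MvPolynomial (E →L[ℝ] ℝ) ℝ,
      (MvPolynomial.aeval (R := ℝ) (fun ℓ : E →L[ℝ] ℝ => (ℓ : E → ℝ)) P' : E → ℝ) =
        (MvPolynomial.aeval (R := ℝ) (fun ℓ : E →L[ℝ] ℝ => (ℓ : E → ℝ)) P) ∘ R := by
  -- precomposition with `R` as an algebra endomorphism of `E → ℝ`
  let φ : (E → ℝ) →ₐ[ℝ] (E → ℝ) :=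
    { toFun := fun F => F ∘ R
      map_one' := rfl
      map_mul' := fun _ _ => rfl
      map_zero' := rfl
      map_add' := fun _ _ => rfl
      commutes' := fun _ => rfl }
  refine ⟨MvPolynomial.rename (fun ℓ : E →L[ℝ] ℝ => ℓ.comp R) P, ?_⟩
  rw [MvPolynomial.aeval_rename]
  have h : (MvPolynomial.aeval (R := ℝ) (fun ℓ : E →L[ℝ] ℝ => (ℓ : E → ℝ)) P) ∘ R =
      (φ.comp (MvPolynomial.aeval (R := ℝ) (fun ℓ : E →L[ℝ] ℝ => (ℓ : E → ℝ)))) P := rfl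
  rw [h, MvPolynomial.comp_aeval]
  rfl

/-- **Derivation along a linear vector field preserves polynomial functions**: for a linear
`T : E → E` the function `x ↦ DP(x)[T x]` is the polynomial function of
`Σ_{ℓ ∈ vars P} ∂_ℓ P · X_{ℓ ∘ T}`. [folklore] -/
theorem exists_aeval_coeFn_eq_fderiv_apply (P : MvPolynomial (E →L[ℝ] ℝ) ℝ) (T : E →L[ℝ] E) :
    ∃ P' : MvPolynomial (E →L[ℝ] ℝ) ℝ, ∀ x : E,
      MvPolynomial.aeval (R := ℝ) (fun ℓ : E →L[ℝ] ℝ => (ℓ : E → ℝ)) P' x =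
        fderiv ℝ (MvPolynomial.aeval (R := ℝ) (fun ℓ : E →L[ℝ] ℝ => (ℓ : E → ℝ)) P) x (T x) := by
  classical
  refine ⟨∑ ℓ ∈ P.vars, MvPolynomial.pderiv ℓ P * X (ℓ.comp T), fun x => ?_⟩
  rw [fderiv_aeval_coeFn_apply, map_sum, Finset.sum_apply]
  refine Finset.sum_congr rfl fun ℓ _ => ?_
  rw [map_mul, MvPolynomial.aeval_X, Pi.mul_apply]
  rfl

/-- **A real-analytic function on `ℝ` all of whose derivatives vanish at `0` is zero.**
[folklore] -/
theorem eq_zero_of_analytic_of_iteratedDeriv_eq_zero {φ : ℝ → ℝ}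
    (hφ : ∀ t, AnalyticAt ℝ φ t) (h0 : ∀ m : ℕ, iteratedDeriv m φ 0 = 0) (t : ℝ) : φ t = 0 := by
  have han : AnalyticOnNhd ℝ φ univ := fun t _ => hφ t
  -- `φ` vanishes near `0`: its Taylor series at `0` is zero
  obtain ⟨p, r, hp⟩ := (hφ 0)
  have hev : ∀ᶠ s in 𝓝 (0 : ℝ), φ s = 0 := by
    have hr : ∀ᶠ s in 𝓝 (0 : ℝ), s ∈ Metric.eball (0 : ℝ) r :=
      Metric.isOpen_eball.mem_nhds (Metric.mem_eball_self hp.r_pos)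
    filter_upwards [hr] with s hs
    have hsum := hp.hasSum_iteratedFDeriv hs
    have hzero : (fun m : ℕ => (m.factorial : ℝ)⁻¹ •
        (iteratedFDeriv ℝ m φ 0) fun _ : Fin m => s) = fun _ => 0 := by
      funext m
      rw [iteratedFDeriv_apply_eq_iteratedDeriv_mul_prod, h0 m, smul_zero, smul_zero]
    rw [hzero, zero_add] at hsum
    exact (hasSum_zero.unique hsum).symm
  have := han.eqOn_zero_of_preconnected_of_eventuallyEq_zero isPreconnected_univ (mem_univ 0) hev
  exact this (mem_univ t)

end PolyCalculus

/-! ### §2. Real separation: Chevalley's theorem with real polynomials -/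

section Separation

variable {n : Type*} [Fintype n] [DecidableEq n]

open scoped Matrix.Norms.Frobenius

variable (gen : ((n × n) ⊕ (n × n)) → C(Matrix.unitaryGroup n ℂ, ℝ))
  (hre : ∀ (i j : n) (U : Matrix.unitaryGroup n ℂ), gen (Sum.inl (i, j)) U = ((U : Matrix n n ℂ) i j).re)
  (him : ∀ (i j : n) (U : Matrix.unitaryGroup n ℂ), gen (Sum.inr (i, j)) U = ((U : Matrix n n ℂ) i j).im)

include hre him in
/-- **Real form of Chevalley's theorem** (Chevalley 1946, Ch. VI §IX; Onishchik–Vinberg Ch. 5 §2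
Thm. 5, proof): for a closed subgroup `K ≤ U(n)` and `x ∈ U(n) ∖ K` there is a REAL polynomial
in `Re U_{ij}, Im U_{ij}` vanishing on `K` and non-zero at `x`. Proof: Stone–Weierstrass
approximation of the right-`K`-invariant function `dist(·, K)` followed by Haar averaging over
`K` inside the finite-dimensional space of polynomial functions of bounded degree
(`exists_invariant_average`), minus the value at `1`.
[cite: Chevalley1946, Ch. VI §§VIII–IX] [cite: OnishchikVinberg1990, Ch. 5 §2 Thm. 5] -/
theorem exists_aeval_gen_eq_zero_ne_zero (K : Subgroup (Matrix.unitaryGroup n ℂ))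
    (hK : IsClosed (K : Set (Matrix.unitaryGroup n ℂ))) {x : Matrix.unitaryGroup n ℂ}
    (hx : x ∉ K) :
    ∃ Q : MvPolynomial ((n × n) ⊕ (n × n)) ℝ,
      (∀ k ∈ K, MvPolynomial.aeval (R := ℝ) gen Q k = 0) ∧
        MvPolynomial.aeval (R := ℝ) gen Q x ≠ 0 := by
  classical
  -- the invariant separating function `f₀ = dist(·, K)`
  set HM : Set (Matrix n n ℂ) :=
    (fun k : Matrix.unitaryGroup n ℂ => (k : Matrix n n ℂ)) '' (K : Set (Matrix.unitaryGroup n ℂ))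
    with hHMdef
  have hHMc : IsClosed HM := (hK.isCompact.image continuous_subtype_val).isClosed
  have hHMne : HM.Nonempty := ⟨1, ⟨1, K.one_mem, rfl⟩⟩
  have hxHM : (x : Matrix n n ℂ) ∉ HM := by
    rintro ⟨h, hh, hhx⟩
    exact hx ((Subtype.ext hhx : h = x) ▸ hh)
  let f₀ : C(Matrix.unitaryGroup n ℂ, ℝ) :=
    ⟨fun U => Metric.infDist (U : Matrix n n ℂ) HM,
      (Metric.continuous_infDist_pt HM).comp continuous_subtype_val⟩
  have hf₀apply : ∀ U : Matrix.unitaryGroup n ℂ, f₀ U = Metric.infDist (U : Matrix n n ℂ) HM :=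
    fun U => rfl
  have hf₀K : ∀ k ∈ K, f₀ k = 0 := fun k hk => by
    rw [hf₀apply]
    exact Metric.infDist_zero_of_mem ⟨k, hk, rfl⟩
  have hf₀x : 0 < f₀ x := (hHMc.notMem_iff_infDist_pos hHMne).1 hxHM
  have hf₀inv : ∀ k ∈ K,
      f₀.comp ⟨fun U : Matrix.unitaryGroup n ℂ => U * k, continuous_mul_const k⟩ = f₀ := by
    intro k hk
    ext U
    change Metric.infDist ((U : Matrix n n ℂ) * (k : Matrix n n ℂ)) HM =
      Metric.infDist (U : Matrix n n ℂ) HM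
    have hiso : Isometry fun A : Matrix n n ℂ => A * (k : Matrix n n ℂ) :=
      Isometry.of_dist_eq fun A B => by
        rw [dist_eq_norm, dist_eq_norm, ← sub_mul, Matrix.frobenius_norm_mul_unitaryGroup]
    have himage : (fun A : Matrix n n ℂ => A * (k : Matrix n n ℂ)) '' HM = HM := by
      ext A
      constructor
      · rintro ⟨_, ⟨h, hh, rfl⟩, rfl⟩
        exact ⟨h * k, K.mul_mem hh hk, rfl⟩
      · rintro ⟨h, hh, rfl⟩
        refine ⟨((h * k⁻¹ : Matrix.unitaryGroup n ℂ) : Matrix n n ℂ),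
          ⟨_, K.mul_mem hh (K.inv_mem hk), rfl⟩, ?_⟩
        change ((h * k⁻¹ : Matrix.unitaryGroup n ℂ) : Matrix n n ℂ) * (k : Matrix n n ℂ) = h
        rw [← Submonoid.coe_mul, inv_mul_cancel_right]
    rw [← himage, Metric.infDist_image hiso, himage]
  -- Stone–Weierstrass: a polynomial function `ε`-close to `f₀`
  set ε : ℝ := f₀ x / 3 with hεdef
  have hε : 0 < ε := by positivity
  obtain ⟨⟨g, hgA⟩, hg⟩ :=
    ContinuousMap.exists_mem_subalgebra_near_continuousMap_of_separatesPoints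
      _ (subalgebra_aeval_range_separatesPoints gen hre him) f₀ ε hε
  obtain ⟨p, rfl⟩ := (AlgHom.mem_range _).1 hgA
  -- the finite-dimensional translation-invariant space of polynomial functions of degree ≤ d
  set d : ℕ := p.totalDegree with hddef
  set V : Submodule ℝ C(Matrix.unitaryGroup n ℂ, ℝ) :=
    Submodule.map (MvPolynomial.aeval (R := ℝ) gen).toLinearMap
      (MvPolynomial.restrictTotalDegree ((n × n) ⊕ (n × n)) ℝ d) with hVdef
  have hpV : MvPolynomial.aeval (R := ℝ) gen p ∈ V :=
    ⟨p, (MvPolynomial.mem_restrictTotalDegree _ _ _).2 le_rfl, rfl⟩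
  have hVinv : ∀ k ∈ K, ∀ F ∈ V,
      F.comp ⟨fun U : Matrix.unitaryGroup n ℂ => U * k, continuous_mul_const k⟩ ∈ V := by
    rintro k - F ⟨q, hq, rfl⟩
    exact comp_mulRight_mem_map_restrictTotalDegree gen hre him d k hq
  obtain ⟨gbar, hgbarV, hgbarinv, hgbarnorm⟩ := exists_invariant_average K hK V hVinv hpV
  have hclose : ‖gbar - f₀‖ < ε := (hgbarnorm f₀ hf₀inv).trans_lt hg
  obtain ⟨P, -, hP⟩ := hgbarV
  have hPg : MvPolynomial.aeval (R := ℝ) gen P = gbar := hP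
  -- `Q = P - P̄(1)` vanishes on `K` and is positive at `x`
  refine ⟨P - MvPolynomial.C (gbar 1), fun k hk => ?_, ?_⟩
  · have hgbar1 : gbar k = gbar 1 := by
      conv_lhs => rw [← one_mul k]
      conv_rhs => rw [← hgbarinv k hk]
      rfl
    rw [map_sub, hPg, MvPolynomial.algHom_C]
    change gbar k - gbar 1 = 0
    rw [hgbar1, sub_self]
  · rw [map_sub, hPg, MvPolynomial.algHom_C]
    change gbar x - gbar 1 ≠ 0
    have h1 : |gbar x - f₀ x| ≤ ‖gbar - f₀‖ := by
      rw [← Real.norm_eq_abs]; exact (gbar - f₀).norm_coe_le_norm x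
    have h2 : |gbar 1 - f₀ 1| ≤ ‖gbar - f₀‖ := by
      rw [← Real.norm_eq_abs]; exact (gbar - f₀).norm_coe_le_norm 1
    rw [hf₀K 1 K.one_mem, sub_zero] at h2
    have h3 := abs_le.1 h1
    have h4 := abs_le.1 h2
    intro h0
    linarith

omit [DecidableEq n] in
/-- **Real coordinates are polynomial functions**: every real polynomial in the `2n²` coordinates
`Re M_{ij}`, `Im M_{ij}` is a (basis-free) polynomial function `aeval (fun ℓ => ⇑ℓ) P` on the real
normed space `M_n(ℂ)` — substitute the coordinate functionals for the variables. [folklore] -/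
theorem exists_aeval_coeFn_eq_eval (Q : MvPolynomial ((n × n) ⊕ (n × n)) ℝ) :
    ∃ P : MvPolynomial (Matrix n n ℂ →L[ℝ] ℝ) ℝ, ∀ M : Matrix n n ℂ,
      MvPolynomial.aeval (R := ℝ) (fun ℓ : Matrix n n ℂ →L[ℝ] ℝ => (ℓ : Matrix n n ℂ → ℝ)) P M =
        MvPolynomial.eval (Sum.elim (fun ij : n × n => (M ij.1 ij.2).re)
          (fun ij : n × n => (M ij.1 ij.2).im)) Q := by
  -- the coordinate functionals
  let c : ((n × n) ⊕ (n × n)) → (Matrix n n ℂ →L[ℝ] ℝ) :=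
    Sum.elim
      (fun ij => Complex.reCLM.comp
        (LinearMap.toContinuousLinearMap
          ((Matrix.entryLinearMap ℂ ℂ ij.1 ij.2).restrictScalars ℝ)))
      (fun ij => Complex.imCLM.comp
        (LinearMap.toContinuousLinearMap
          ((Matrix.entryLinearMap ℂ ℂ ij.1 ij.2).restrictScalars ℝ)))
  have hc : ∀ (M : Matrix n n ℂ) (s : (n × n) ⊕ (n × n)), c s M =
      Sum.elim (fun ij : n × n => (M ij.1 ij.2).re) (fun ij : n × n => (M ij.1 ij.2).im) s := by
    intro M s
    rcases s with ⟨i, j⟩ | ⟨i, j⟩ <;> rfl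
  refine ⟨MvPolynomial.rename c Q, fun M => ?_⟩
  rw [MvPolynomial.aeval_rename, show ((fun ℓ : Matrix n n ℂ →L[ℝ] ℝ => (ℓ : Matrix n n ℂ → ℝ)) ∘ c) =
    fun s => (c s : Matrix n n ℂ → ℝ) from rfl, aeval_pi_apply, ← funext (hc M)]

include hre him in
/-- **Real separation, basis-free form**: for a closed `K ≤ U(n)` and `x ∈ U(n) ∖ K` some real
polynomial function on `M_n(ℂ)` vanishes on `K` and not at `x`.
[cite: Chevalley1946, Ch. VI §§VIII–IX] -/
theorem exists_aeval_coeFn_eq_zero_ne_zero (K : Subgroup (Matrix.unitaryGroup n ℂ))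
    (hK : IsClosed (K : Set (Matrix.unitaryGroup n ℂ))) {x : Matrix.unitaryGroup n ℂ}
    (hx : x ∉ K) :
    ∃ P : MvPolynomial (Matrix n n ℂ →L[ℝ] ℝ) ℝ,
      (∀ k ∈ K, MvPolynomial.aeval (R := ℝ)
        (fun ℓ : Matrix n n ℂ →L[ℝ] ℝ => (ℓ : Matrix n n ℂ → ℝ)) P (k : Matrix n n ℂ) = 0) ∧
      MvPolynomial.aeval (R := ℝ)
        (fun ℓ : Matrix n n ℂ →L[ℝ] ℝ => (ℓ : Matrix n n ℂ → ℝ)) P (x : Matrix n n ℂ) ≠ 0 := by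
  obtain ⟨Q, hQK, hQx⟩ := exists_aeval_gen_eq_zero_ne_zero gen hre him K hK hx
  obtain ⟨P, hP⟩ := exists_aeval_coeFn_eq_eval Q
  refine ⟨P, fun k hk => ?_, ?_⟩
  · rw [hP, ← aeval_gen_apply gen hre him, hQK k hk]
  · rw [hP, ← aeval_gen_apply gen hre him]; exact hQx

end Separation

/-! ### §3. The Zariski tangent space at `1` is the Lie algebra -/

section Tangent

variable {n : Type*} [Fintype n] [DecidableEq n]

open scoped Matrix.Norms.Frobenius


omit [DecidableEq n] in
/-- **The unitarity relations are polynomial**: `M ↦ Re (Mᴴ M)_{ij}` and `M ↦ Im (Mᴴ M)_{ij}` are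
real polynomial functions on `M_n(ℂ)`. [folklore] -/
theorem exists_aeval_coeFn_eq_conjTranspose_mul (i j : n) :
    (∃ P : MvPolynomial (Matrix n n ℂ →L[ℝ] ℝ) ℝ, ∀ M : Matrix n n ℂ,
      MvPolynomial.aeval (R := ℝ) (fun ℓ : Matrix n n ℂ →L[ℝ] ℝ => (ℓ : Matrix n n ℂ → ℝ)) P M =
        ((M.conjTranspose * M) i j).re) ∧
    (∃ P : MvPolynomial (Matrix n n ℂ →L[ℝ] ℝ) ℝ, ∀ M : Matrix n n ℂ,
      MvPolynomial.aeval (R := ℝ) (fun ℓ : Matrix n n ℂ →L[ℝ] ℝ => (ℓ : Matrix n n ℂ → ℝ)) P M =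
        ((M.conjTranspose * M) i j).im) := by
  have hre : ∀ M : Matrix n n ℂ, ((M.conjTranspose * M) i j).re =
      ∑ l, ((M l i).re * (M l j).re + (M l i).im * (M l j).im) := by
    intro M
    rw [Matrix.mul_apply, Complex.re_sum]
    refine Finset.sum_congr rfl fun l _ => ?_
    rw [Matrix.conjTranspose_apply, Complex.star_def, Complex.mul_re, Complex.conj_re,
      Complex.conj_im]
    ring
  have him : ∀ M : Matrix n n ℂ, ((M.conjTranspose * M) i j).im =
      ∑ l, ((M l i).re * (M l j).im - (M l i).im * (M l j).re) := by
    intro M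
    rw [Matrix.mul_apply, Complex.im_sum]
    refine Finset.sum_congr rfl fun l _ => ?_
    rw [Matrix.conjTranspose_apply, Complex.star_def, Complex.mul_im, Complex.conj_re,
      Complex.conj_im]
    ring
  constructor
  · obtain ⟨P, hP⟩ := exists_aeval_coeFn_eq_eval (n := n)
      (∑ l : n, (X (Sum.inl (l, i)) * X (Sum.inl (l, j)) + X (Sum.inr (l, i)) * X (Sum.inr (l, j)) :
        MvPolynomial ((n × n) ⊕ (n × n)) ℝ))
    refine ⟨P, fun M => ?_⟩
    rw [hP, hre, map_sum]
    refine Finset.sum_congr rfl fun l _ => ?_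
    simp only [map_add, map_mul, MvPolynomial.eval_X, Sum.elim_inl, Sum.elim_inr]
  · obtain ⟨P, hP⟩ := exists_aeval_coeFn_eq_eval (n := n)
      (∑ l : n, (X (Sum.inl (l, i)) * X (Sum.inr (l, j)) - X (Sum.inr (l, i)) * X (Sum.inl (l, j)) :
        MvPolynomial ((n × n) ⊕ (n × n)) ℝ))
    refine ⟨P, fun M => ?_⟩
    rw [hP, him, map_sum]
    refine Finset.sum_congr rfl fun l _ => ?_
    simp only [map_sub, map_mul, MvPolynomial.eval_X, Sum.elim_inl, Sum.elim_inr]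

/-- **Derivative along the flow of a right-invariant vector field**:
`d/dt P(exp(tA)) = DP(exp tA)[A exp tA]`. [folklore] -/
theorem hasDerivAt_aeval_coeFn_exp_smul (P : MvPolynomial (Matrix n n ℂ →L[ℝ] ℝ) ℝ)
    (A : Matrix n n ℂ) (t : ℝ) :
    HasDerivAt (fun s : ℝ => MvPolynomial.aeval (R := ℝ)
        (fun ℓ : Matrix n n ℂ →L[ℝ] ℝ => (ℓ : Matrix n n ℂ → ℝ)) P (NormedSpace.exp (s • A)))
      (fderiv ℝ (MvPolynomial.aeval (R := ℝ)
        (fun ℓ : Matrix n n ℂ →L[ℝ] ℝ => (ℓ : Matrix n n ℂ → ℝ)) P) (NormedSpace.exp (t • A))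
          (A * NormedSpace.exp (t • A))) t := by
  classical
  have h1 := (hasFDerivAt_aeval_coeFn P (NormedSpace.exp (t • A))).differentiableAt.hasFDerivAt
  have h2 := hasDerivAt_exp_smul_const' (𝕂 := ℝ) A t
  exact h1.comp_hasDerivAt t h2

/-- The flow curve `t ↦ P(exp(tA))` of a polynomial function is real-analytic. [folklore] -/
theorem analyticAt_aeval_coeFn_exp_smul (P : MvPolynomial (Matrix n n ℂ →L[ℝ] ℝ) ℝ)
    (A : Matrix n n ℂ) (t : ℝ) :
    AnalyticAt ℝ (fun s : ℝ => MvPolynomial.aeval (R := ℝ)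
        (fun ℓ : Matrix n n ℂ →L[ℝ] ℝ => (ℓ : Matrix n n ℂ → ℝ)) P (NormedSpace.exp (s • A))) t := by
  have h1 : AnalyticAt ℝ (fun u : ℝ => u • A) t :=
    ((ContinuousLinearMap.id ℝ ℝ).analyticAt t).smul analyticAt_const
  have h2 : AnalyticAt ℝ (fun u : ℝ => NormedSpace.exp (u • A)) t :=
    AnalyticAt.comp (g := NormedSpace.exp) (f := fun u : ℝ => u • A)
      (NormedSpace.exp_analytic (𝕂 := ℝ) _) h1
  exact AnalyticAt.comp (g := MvPolynomial.aeval (R := ℝ)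
      (fun ℓ : Matrix n n ℂ →L[ℝ] ℝ => (ℓ : Matrix n n ℂ → ℝ)) P)
    (f := fun u : ℝ => NormedSpace.exp (u • A)) (analyticAt_aeval_coeFn P _) h2

-- The product topology of `M_n(ℂ)` and the topology of its Frobenius norm are only
-- reducibly-different instances (tree idiom, cf. `QuantumFieldTheory/WilsonPartitionLaplaceForm`).
set_option backward.isDefEq.respectTransparency false in
/-- **The real Zariski tangent space of a compact matrix group at `1` is its Lie algebra.** Let
`K ≤ U(n)` be a closed subgroup and `A ∈ M_n(ℂ)`. Then `DP(1)[A] = 0` for every real polynomial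
function `P` on `M_n(ℂ)` vanishing on `K` if and only if `exp(tA) ∈ K` for all `t ∈ ℝ`
(Chevalley 1946, Ch. VI; Onishchik–Vinberg, Ch. 3 §3 and Ch. 5 §2 Thm. 5: a compact linear group
is a real algebraic group, and the tangent algebra of a real algebraic group is the Zariski tangent
space of its ideal). Proof: the ideal `I(K)` of polynomial functions vanishing on `K` is stable
under right translations by `K`, hence under the derivation `∂_A P(M) = DP(M)[AM]` for `A` in the
tangent space; so all derivatives of the analytic function `t ↦ P(exp tA)` vanish at `0`, whence
`P(exp tA) = 0` for all `P ∈ I(K)`; the unitarity relations give `exp tA ∈ U(n)` and the real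
separation theorem `exists_aeval_coeFn_eq_zero_ne_zero` gives `exp tA ∈ K`. [folklore] -/
theorem fderiv_eq_zero_iff_forall_exp_mem (K : Subgroup (Matrix.unitaryGroup n ℂ))
    (hK : IsClosed (K : Set (Matrix.unitaryGroup n ℂ))) (A : Matrix n n ℂ) :
    (∀ P : MvPolynomial (Matrix n n ℂ →L[ℝ] ℝ) ℝ,
        (∀ k ∈ K, MvPolynomial.aeval (R := ℝ)
          (fun ℓ : Matrix n n ℂ →L[ℝ] ℝ => (ℓ : Matrix n n ℂ → ℝ)) P (k : Matrix n n ℂ) = 0) →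
        fderiv ℝ (MvPolynomial.aeval (R := ℝ)
          (fun ℓ : Matrix n n ℂ →L[ℝ] ℝ => (ℓ : Matrix n n ℂ → ℝ)) P) 1 A = 0) ↔
      ∀ t : ℝ, ∃ k ∈ K, ((k : Matrix.unitaryGroup n ℂ) : Matrix n n ℂ) = NormedSpace.exp (t • A) := by
  classical
  -- the derivative of the flow curve at `0`
  have hflow0 : ∀ P : MvPolynomial (Matrix n n ℂ →L[ℝ] ℝ) ℝ,
      HasDerivAt (fun s : ℝ => MvPolynomial.aeval (R := ℝ) (fun ℓ : Matrix n n ℂ →L[ℝ] ℝ => (ℓ : Matrix n n ℂ → ℝ)) P (NormedSpace.exp (s • A)))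
        (fderiv ℝ (MvPolynomial.aeval (R := ℝ) (fun ℓ : Matrix n n ℂ →L[ℝ] ℝ => (ℓ : Matrix n n ℂ → ℝ)) P) 1 A) 0 := by
    intro P
    have h := hasDerivAt_aeval_coeFn_exp_smul P A 0
    rwa [zero_smul, NormedSpace.exp_zero, mul_one] at h
  constructor
  · intro hA t
    ------------------------------------------------------------------------------------------
    -- Step 1: the ideal `I(K)` and its stability under `∂_A`
    ------------------------------------------------------------------------------------------
    -- `DP(k)[Ak] = 0` for `P ∈ I(K)`, `k ∈ K` (translate to `1`)
    have htransl : ∀ P : MvPolynomial (Matrix n n ℂ →L[ℝ] ℝ) ℝ,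
        (∀ k ∈ K, MvPolynomial.aeval (R := ℝ) (fun ℓ : Matrix n n ℂ →L[ℝ] ℝ => (ℓ : Matrix n n ℂ → ℝ)) P (k : Matrix n n ℂ) = 0) →
        ∀ k ∈ K, fderiv ℝ (MvPolynomial.aeval (R := ℝ) (fun ℓ : Matrix n n ℂ →L[ℝ] ℝ => (ℓ : Matrix n n ℂ → ℝ)) P) (k : Matrix n n ℂ)
          (A * (k : Matrix n n ℂ)) = 0 := by
      intro P hP k hk
      set Rk : Matrix n n ℂ →L[ℝ] Matrix n n ℂ :=
        (ContinuousLinearMap.mul ℝ (Matrix n n ℂ)).flip (k : Matrix n n ℂ) with hRk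
      have hRk_apply : ∀ M : Matrix n n ℂ, Rk M = M * (k : Matrix n n ℂ) := fun M => rfl
      obtain ⟨P', hP'⟩ := exists_aeval_coeFn_comp_clm P Rk
      have hP'K : ∀ k' ∈ K, MvPolynomial.aeval (R := ℝ) (fun ℓ : Matrix n n ℂ →L[ℝ] ℝ => (ℓ : Matrix n n ℂ → ℝ)) P' (k' : Matrix n n ℂ) = 0 := by
        intro k' hk'
        have h1 := congrFun hP' (k' : Matrix n n ℂ)
        refine h1.trans ?_
        rw [Function.comp_apply, hRk_apply, ← Submonoid.coe_mul]
        exact hP (k' * k) (K.mul_mem hk' hk)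
      have h0 := hA P' hP'K
      have hdiff : DifferentiableAt ℝ (MvPolynomial.aeval (R := ℝ) (fun ℓ : Matrix n n ℂ →L[ℝ] ℝ => (ℓ : Matrix n n ℂ → ℝ)) P) (Rk 1) :=
        (hasFDerivAt_aeval_coeFn P _).differentiableAt
      have h2 : fderiv ℝ (MvPolynomial.aeval (R := ℝ) (fun ℓ : Matrix n n ℂ →L[ℝ] ℝ => (ℓ : Matrix n n ℂ → ℝ)) P') 1 =
          (fderiv ℝ (MvPolynomial.aeval (R := ℝ) (fun ℓ : Matrix n n ℂ →L[ℝ] ℝ => (ℓ : Matrix n n ℂ → ℝ)) P) (Rk 1)).comp Rk := by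
        have h3 := congrArg (fun F : Matrix n n ℂ → ℝ => fderiv ℝ F 1) hP'
        refine h3.trans ?_
        exact fderiv_comp _ hdiff Rk.differentiableAt |>.trans (by rw [Rk.fderiv])
      rw [h2, ContinuousLinearMap.comp_apply, hRk_apply, hRk_apply, one_mul] at h0
      exact h0
    -- the derivation `∂_A` on polynomial functions
    obtain ⟨D, hD⟩ : ∃ D : MvPolynomial (Matrix n n ℂ →L[ℝ] ℝ) ℝ →
        MvPolynomial (Matrix n n ℂ →L[ℝ] ℝ) ℝ, ∀ P M,
        MvPolynomial.aeval (R := ℝ) (fun ℓ : Matrix n n ℂ →L[ℝ] ℝ => (ℓ : Matrix n n ℂ → ℝ)) (D P) M =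
          fderiv ℝ (MvPolynomial.aeval (R := ℝ) (fun ℓ : Matrix n n ℂ →L[ℝ] ℝ => (ℓ : Matrix n n ℂ → ℝ)) P) M (A * M) := by
      have h := fun P : MvPolynomial (Matrix n n ℂ →L[ℝ] ℝ) ℝ =>
        exists_aeval_coeFn_eq_fderiv_apply P (ContinuousLinearMap.mul ℝ (Matrix n n ℂ) A)
      choose D hD using h
      exact ⟨D, fun P M => hD P M⟩
    -- `∂_A` preserves `I(K)`, and so do its iterates
    have hDvan : ∀ P : MvPolynomial (Matrix n n ℂ →L[ℝ] ℝ) ℝ,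
        (∀ k ∈ K, MvPolynomial.aeval (R := ℝ) (fun ℓ : Matrix n n ℂ →L[ℝ] ℝ => (ℓ : Matrix n n ℂ → ℝ)) P (k : Matrix n n ℂ) = 0) →
        ∀ k ∈ K, MvPolynomial.aeval (R := ℝ) (fun ℓ : Matrix n n ℂ →L[ℝ] ℝ => (ℓ : Matrix n n ℂ → ℝ)) (D P) (k : Matrix n n ℂ) = 0 := by
      intro P hP k hk
      rw [hD]
      exact htransl P hP k hk
    have hDiter : ∀ (m : ℕ) (P : MvPolynomial (Matrix n n ℂ →L[ℝ] ℝ) ℝ),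
        (∀ k ∈ K, MvPolynomial.aeval (R := ℝ) (fun ℓ : Matrix n n ℂ →L[ℝ] ℝ => (ℓ : Matrix n n ℂ → ℝ)) P (k : Matrix n n ℂ) = 0) →
        ∀ k ∈ K, MvPolynomial.aeval (R := ℝ) (fun ℓ : Matrix n n ℂ →L[ℝ] ℝ => (ℓ : Matrix n n ℂ → ℝ)) (D^[m] P) (k : Matrix n n ℂ) = 0 := by
      intro m
      induction m with
      | zero => intro P hP; simpa using hP
      | succ m ih =>
        intro P hP
        rw [Function.iterate_succ_apply]
        exact ih (D P) (hDvan P hP)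
    ------------------------------------------------------------------------------------------
    -- Step 2: all derivatives of `t ↦ P(exp tA)` vanish at `0`, hence `P(exp tA) = 0`
    ------------------------------------------------------------------------------------------
    have hiter : ∀ (m : ℕ) (P : MvPolynomial (Matrix n n ℂ →L[ℝ] ℝ) ℝ),
        iteratedDeriv m (fun s : ℝ => MvPolynomial.aeval (R := ℝ) (fun ℓ : Matrix n n ℂ →L[ℝ] ℝ => (ℓ : Matrix n n ℂ → ℝ)) P (NormedSpace.exp (s • A))) =
          fun t : ℝ => MvPolynomial.aeval (R := ℝ) (fun ℓ : Matrix n n ℂ →L[ℝ] ℝ => (ℓ : Matrix n n ℂ → ℝ)) (D^[m] P) (NormedSpace.exp (t • A)) := by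
      intro m
      induction m with
      | zero => intro P; simp
      | succ m ih =>
        intro P
        rw [iteratedDeriv_succ', Function.iterate_succ_apply, ← ih (D P)]
        congr 1
        funext t
        rw [(hasDerivAt_aeval_coeFn_exp_smul P A t).deriv, hD]
    have hzero : ∀ P : MvPolynomial (Matrix n n ℂ →L[ℝ] ℝ) ℝ,
        (∀ k ∈ K, MvPolynomial.aeval (R := ℝ) (fun ℓ : Matrix n n ℂ →L[ℝ] ℝ => (ℓ : Matrix n n ℂ → ℝ)) P (k : Matrix n n ℂ) = 0) →
        ∀ s : ℝ, MvPolynomial.aeval (R := ℝ) (fun ℓ : Matrix n n ℂ →L[ℝ] ℝ => (ℓ : Matrix n n ℂ → ℝ)) P (NormedSpace.exp (s • A)) = 0 := by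
      intro P hP s
      refine eq_zero_of_analytic_of_iteratedDeriv_eq_zero
        (fun t => analyticAt_aeval_coeFn_exp_smul P A t) (fun m => ?_) s
      rw [hiter m P]
      dsimp only
      rw [zero_smul, NormedSpace.exp_zero]
      simpa using hDiter m P hP 1 K.one_mem
    ------------------------------------------------------------------------------------------
    -- Step 3: `exp(tA)` is unitary (the unitarity relations lie in `I(K)`)
    ------------------------------------------------------------------------------------------
    have hunit : NormedSpace.exp (t • A) ∈ Matrix.unitaryGroup n ℂ := by
      rw [Matrix.mem_unitaryGroup_iff', Matrix.star_eq_conjTranspose]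
      ext i j
      obtain ⟨⟨Pr, hPr⟩, ⟨Pm, hPm⟩⟩ := exists_aeval_coeFn_eq_conjTranspose_mul (n := n) i j
      have hK1 : ∀ k ∈ K, ((k : Matrix n n ℂ).conjTranspose * (k : Matrix n n ℂ)) = 1 := by
        intro k _
        have := Matrix.mem_unitaryGroup_iff'.1 k.2
        rwa [Matrix.star_eq_conjTranspose] at this
      -- real part
      have hre0 := hzero (Pr - MvPolynomial.C (if i = j then 1 else 0)) (fun k hk => by
        rw [map_sub, Pi.sub_apply, hPr, hK1 k hk, MvPolynomial.algHom_C, Pi.algebraMap_apply,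
          Algebra.algebraMap_self, RingHom.id_apply, Matrix.one_apply]
        split_ifs <;> simp) t
      rw [map_sub, Pi.sub_apply, hPr, MvPolynomial.algHom_C, Pi.algebraMap_apply,
        Algebra.algebraMap_self, RingHom.id_apply, sub_eq_zero] at hre0
      -- imaginary part
      have him0 := hzero Pm (fun k hk => by
        rw [hPm, hK1 k hk, Matrix.one_apply]; split_ifs <;> simp) t
      rw [hPm] at him0
      apply Complex.ext
      · rw [hre0, Matrix.one_apply]; split_ifs <;> simp
      · rw [him0, Matrix.one_apply]; split_ifs <;> simp
    ------------------------------------------------------------------------------------------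
    -- Step 4: real separation
    ------------------------------------------------------------------------------------------
    by_contra hcon
    push Not at hcon
    set x : Matrix.unitaryGroup n ℂ := ⟨NormedSpace.exp (t • A), hunit⟩ with hx
    have hxK : x ∉ K := fun hxK => hcon x hxK rfl
    obtain ⟨gen, hgre, hgim⟩ := exists_gen (n := n)
    obtain ⟨P, hPK, hPx⟩ := exists_aeval_coeFn_eq_zero_ne_zero gen hgre hgim K hK hxK
    exact hPx (hzero P hPK t)
  · intro h P hP
    have hconst : (fun s : ℝ => MvPolynomial.aeval (R := ℝ) (fun ℓ : Matrix n n ℂ →L[ℝ] ℝ => (ℓ : Matrix n n ℂ → ℝ)) P (NormedSpace.exp (s • A))) =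
        fun _ => 0 := by
      funext s
      obtain ⟨k, hk, hks⟩ := h s
      rw [← hks]
      exact hP k hk
    have h1 := hflow0 P
    rw [hconst] at h1
    exact h1.unique (hasDerivAt_const (0 : ℝ) (0 : ℝ))

set_option backward.isDefEq.respectTransparency false in
/-- **Equations of the right rank for a compact matrix group.** For a closed `K ≤ U(n)` there are
finitely many real polynomial functions `P₁, …, P_c` on `M_n(ℂ)` vanishing on `K` whose
differentials at `1` are linearly independent and whose joint kernel is exactly the Lie algebra
`𝔨 = {A | exp(ℝA) ⊆ K}` (Onishchik–Vinberg, Ch. 3 §3 and Ch. 5 §2 Thm. 5; Chevalley 1946 Ch. VI).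
[folklore] -/
theorem exists_fin_polys_linearIndependent_tangent (K : Subgroup (Matrix.unitaryGroup n ℂ))
    (hK : IsClosed (K : Set (Matrix.unitaryGroup n ℂ))) :
    ∃ (c : ℕ) (P : Fin c → MvPolynomial (Matrix n n ℂ →L[ℝ] ℝ) ℝ),
      (∀ i, ∀ k ∈ K, MvPolynomial.aeval (R := ℝ)
        (fun ℓ : Matrix n n ℂ →L[ℝ] ℝ => (ℓ : Matrix n n ℂ → ℝ)) (P i) (k : Matrix n n ℂ) = 0) ∧
      LinearIndependent ℝ (fun i => fderiv ℝ (MvPolynomial.aeval (R := ℝ)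
        (fun ℓ : Matrix n n ℂ →L[ℝ] ℝ => (ℓ : Matrix n n ℂ → ℝ)) (P i)) (1 : Matrix n n ℂ)) ∧
      ∀ A : Matrix n n ℂ,
        (∀ i, fderiv ℝ (MvPolynomial.aeval (R := ℝ)
          (fun ℓ : Matrix n n ℂ →L[ℝ] ℝ => (ℓ : Matrix n n ℂ → ℝ)) (P i)) 1 A = 0) ↔
        ∀ t : ℝ, ∃ k ∈ K, ((k : Matrix.unitaryGroup n ℂ) : Matrix n n ℂ) = NormedSpace.exp (t • A) := by
  classical
  -- the differentials at `1` of the polynomial functions vanishing on `K`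
  set S : Set (Matrix n n ℂ →L[ℝ] ℝ) := {L | ∃ P : MvPolynomial (Matrix n n ℂ →L[ℝ] ℝ) ℝ,
    (∀ k ∈ K, MvPolynomial.aeval (R := ℝ) (fun ℓ : Matrix n n ℂ →L[ℝ] ℝ => (ℓ : Matrix n n ℂ → ℝ)) P (k : Matrix n n ℂ) = 0) ∧
      fderiv ℝ (MvPolynomial.aeval (R := ℝ) (fun ℓ : Matrix n n ℂ →L[ℝ] ℝ => (ℓ : Matrix n n ℂ → ℝ)) P) 1 = L} with hS
  obtain ⟨b, hbS, hspan, hli⟩ := exists_linearIndependent ℝ S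
  have hli' : LinearIndependent ℝ (fun L : b => (L : Matrix n n ℂ →L[ℝ] ℝ)) := hli
  have hfin : b.Finite := hli'.setFinite
  haveI : Fintype b := hfin.fintype
  set e := Fintype.equivFin b with he
  have hmem : ∀ i : Fin (Fintype.card b), ((e.symm i : b) : Matrix n n ℂ →L[ℝ] ℝ) ∈ S :=
    fun i => hbS (e.symm i).2
  choose P hPK hPL using hmem
  refine ⟨Fintype.card b, P, hPK, ?_, fun A => ?_⟩
  · have : (fun i => fderiv ℝ (MvPolynomial.aeval (R := ℝ) (fun ℓ : Matrix n n ℂ →L[ℝ] ℝ => (ℓ : Matrix n n ℂ → ℝ)) (P i)) (1 : Matrix n n ℂ)) =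
        (fun L : b => (L : Matrix n n ℂ →L[ℝ] ℝ)) ∘ e.symm := funext fun i => hPL i
    rw [this]
    exact hli'.comp _ e.symm.injective
  · rw [← fderiv_eq_zero_iff_forall_exp_mem K hK A]
    constructor
    · intro hA Q hQ
      -- `fderiv Q 1 ∈ S ⊆ span b`, and every element of `span b` kills `A`
      have hQS : fderiv ℝ (MvPolynomial.aeval (R := ℝ) (fun ℓ : Matrix n n ℂ →L[ℝ] ℝ => (ℓ : Matrix n n ℂ → ℝ)) Q) 1 ∈ Submodule.span ℝ b := by
        rw [hspan]
        exact Submodule.subset_span ⟨Q, hQ, rfl⟩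
      have hker : ∀ L ∈ Submodule.span ℝ b, (L : Matrix n n ℂ →L[ℝ] ℝ) A = 0 := by
        intro L hL
        refine Submodule.span_induction (fun L hL => ?_) (by simp) (fun L L' _ _ h h' => by
          simp [h, h']) (fun r L _ h => by simp [h]) hL
        have : L = fderiv ℝ (MvPolynomial.aeval (R := ℝ) (fun ℓ : Matrix n n ℂ →L[ℝ] ℝ => (ℓ : Matrix n n ℂ → ℝ)) (P (e ⟨L, hL⟩))) 1 := by
          rw [hPL]; simp
        rw [this]
        exact hA _
      exact hker _ hQS
    · intro hA i
      exact hA (P i) (hPK i)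

end Tangent

end Literature.RepresentationTheory.CompactGroups
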